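import Summits.KontsevichZagierPeriods.KontsevichZagierPeriods.Theorems.MzvKernelInKZ.Negative.SquareDissection

/-!
# `MzvKernelInKZ` (stmt-KontsevichZagierPeriods-3914): negative side — the Calabi change of variables in dimension 2, semialgebraically

Companion of `Negative/SquareDissection.lean`.  **Calabi's map `(u₀,u₁) ↦ (sin u₀/cos u₁,
sin u₁/cos u₀)` in half-angle coordinates is a RATIONAL bijection `P₂ → (0,1)²`** with Jacobian
`g(t₀)g(t₁)(1 − x²y²)` (`det_cal2Deriv`), injective by the algebraic identity
`sin²u₀ · (1 − x²y²) = x²(1 − y²)` (`Sn_sq_eq_of_cal2`), onto by the half-angle of an arcsine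
`T(s) = √s/(1 + √(1−s))` (`Tg_facts`, `image_cal2`), `ℚ`-semialgebraic; so
`[P₂, g⊗g] − [□², 1/(1−x²y²)]` is ONE change-of-variables move of the calculus
(`Trirep_sub_T2rep_mem_cov`) and **`Q² ≡ 2·[□², 1/(1−x²y²)]`** (`of_G2_sub_two_T2rep_mem`;
`(π/2)² = 2·Σ_odd n⁻²`).

Sources: F. Beukers, J. A. C. Kolk, E. Calabi, *Sums of generalized harmonic series and volumes*, Nieuw Arch. Wisk. (4) 11 (1993), 217–224, §1; M. Kontsevich, D. Zagier, *Periods* (2001), §1.2 (rule (2); §1.1 presents this computation as an example).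
-/

noncomputable section

namespace Summit.KontsevichZagierPeriods.MzvKernelInKZ.Negative

open Set MeasureTheory MvPolynomial
open Literature.NumberTheory.Transcendental
open Literature.ModelTheory.ExponentialFields (IsSemialgebraic)

/-- `d(sin u)/dt = cos u · g(t)`. [folklore] -/
theorem hasDerivAt_Sn (t : ℝ) : HasDerivAt Sn (Cs t * gq t) t := by
  have hc : HasDerivAt (fun s : ℝ => 2 * s) 2 t := by
    simpa using (hasDerivAt_id t).const_mul 2
  have hd : HasDerivAt (fun s : ℝ => 1 + s ^ 2) (2 * t) t := by
    simpa using ((hasDerivAt_id t).pow 2).const_add 1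
  have h := hc.div hd (one_add_sq_ne t)
  have e : (2 * (1 + t ^ 2) - 2 * t * (2 * t)) / (1 + t ^ 2) ^ 2 = Cs t * gq t := by
    simp only [Cs, gq]; field_simp; ring
  rw [e] at h
  exact h

/-- `d(cos u)/dt = −sin u · g(t)`. [folklore] -/
theorem hasDerivAt_Cs (t : ℝ) : HasDerivAt Cs (-(Sn t * gq t)) t := by
  have hc : HasDerivAt (fun s : ℝ => 1 - s ^ 2) (-(2 * t)) t := by
    simpa using ((hasDerivAt_id t).pow 2).const_sub 1
  have hd : HasDerivAt (fun s : ℝ => 1 + s ^ 2) (2 * t) t := by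
    simpa using ((hasDerivAt_id t).pow 2).const_add 1
  have h := hc.div hd (one_add_sq_ne t)
  have e : (-(2 * t) * (1 + t ^ 2) - (1 - t ^ 2) * (2 * t)) / (1 + t ^ 2) ^ 2 = -(Sn t * gq t) := by
    simp only [Sn, gq]; field_simp; ring
  rw [e] at h
  exact h

/-- Derivative of `1/cos` in the half-angle parameter. [folklore] -/
theorem hasDerivAt_inv_Cs {t : ℝ} (h : Cs t ≠ 0) :
    HasDerivAt (fun s => (Cs s)⁻¹) (Sn t * gq t / Cs t ^ 2) t := by
  have h1 := (hasDerivAt_inv h).comp t (hasDerivAt_Cs t)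
  have e : -(Cs t ^ 2)⁻¹ * -(Sn t * gq t) = Sn t * gq t / Cs t ^ 2 := by field_simp
  rw [e] at h1
  exact h1

/-- The Calabi map `(u₀,u₁) ↦ (sin u₀ / cos u₁, sin u₁ / cos u₀)` in half-angle coordinates. [folklore] -/
def cal2 (z : Fin 2 → ℝ) : Fin 2 → ℝ := ![Sn (z 0) * (Cs (z 1))⁻¹, Sn (z 1) * (Cs (z 0))⁻¹]

/-- First component of the Calabi map. [folklore] -/
@[simp] theorem cal2_zero (z : Fin 2 → ℝ) : cal2 z 0 = Sn (z 0) * (Cs (z 1))⁻¹ := rfl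
/-- Second component of the Calabi map. [folklore] -/
@[simp] theorem cal2_one (z : Fin 2 → ℝ) : cal2 z 1 = Sn (z 1) * (Cs (z 0))⁻¹ := rfl

/-- Its Jacobian matrix. [folklore] -/
def cal2Jac (z : Fin 2 → ℝ) : Matrix (Fin 2) (Fin 2) ℝ :=
  !![Cs (z 0) * gq (z 0) * (Cs (z 1))⁻¹, Sn (z 0) * (Sn (z 1) * gq (z 1) / Cs (z 1) ^ 2);
     Sn (z 1) * (Sn (z 0) * gq (z 0) / Cs (z 0) ^ 2), Cs (z 1) * gq (z 1) * (Cs (z 0))⁻¹]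

/-- Its derivative. [folklore] -/
def cal2Deriv (z : Fin 2 → ℝ) : (Fin 2 → ℝ) →L[ℝ] (Fin 2 → ℝ) :=
  LinearMap.toContinuousLinearMap (Matrix.toLin' (cal2Jac z))

/-- **The Jacobian of the Calabi map is `g(t₀)g(t₁)(1 − x²y²)`** (Beukers–Kolk–Calabi). [folklore] -/
theorem det_cal2Deriv {z : Fin 2 → ℝ} (h0 : Cs (z 0) ≠ 0) (h1 : Cs (z 1) ≠ 0) :
    (cal2Deriv z).det = gq (z 0) * gq (z 1) * (1 - (cal2 z 0) ^ 2 * (cal2 z 1) ^ 2) := by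
  have h : (cal2Jac z).det = gq (z 0) * gq (z 1) * (1 - (cal2 z 0) ^ 2 * (cal2 z 1) ^ 2) := by
    rw [Matrix.det_fin_two]
    simp only [cal2Jac, cal2_zero, cal2_one, Matrix.of_apply, Matrix.cons_val', Matrix.cons_val_zero,
      Matrix.cons_val_one, Matrix.empty_val', Matrix.cons_val_fin_one]
    field_simp
  rw [← h]
  exact LinearMap.det_toLin' _

/-- Differentiability of `cal2` with the stated derivative. [folklore] -/
theorem hasFDerivAt_cal2 {z : Fin 2 → ℝ} (h0 : Cs (z 0) ≠ 0) (h1 : Cs (z 1) ≠ 0) :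
    HasFDerivAt cal2 (cal2Deriv z) z := by
  have p0 : HasFDerivAt (fun y : Fin 2 → ℝ => y 0)
      (ContinuousLinearMap.proj (R := ℝ) (φ := fun _ : Fin 2 => ℝ) 0) z := hasFDerivAt_apply 0 z
  have p1 : HasFDerivAt (fun y : Fin 2 → ℝ => y 1)
      (ContinuousLinearMap.proj (R := ℝ) (φ := fun _ : Fin 2 => ℝ) 1) z := hasFDerivAt_apply 1 z
  have s0 := (hasDerivAt_Sn (z 0)).comp_hasFDerivAt z p0
  have s1 := (hasDerivAt_Sn (z 1)).comp_hasFDerivAt z p1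
  have i0 := (hasDerivAt_inv_Cs h0).comp_hasFDerivAt z p0
  have i1 := (hasDerivAt_inv_Cs h1).comp_hasFDerivAt z p1
  have c0 : HasFDerivAt (fun y : Fin 2 → ℝ => cal2 y 0) ((ContinuousLinearMap.proj 0).comp (cal2Deriv z)) z := by
    refine (s0.mul i1).congr_fderiv ?_
    ext v
    simp [cal2Deriv, cal2Jac, dotProduct, Fin.sum_univ_two, Function.comp]
    ring
  have c1 : HasFDerivAt (fun y : Fin 2 → ℝ => cal2 y 1) ((ContinuousLinearMap.proj 1).comp (cal2Deriv z)) z := by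
    refine (s1.mul i0).congr_fderiv ?_
    ext v
    simp [cal2Deriv, cal2Jac, dotProduct, Fin.sum_univ_two, Function.comp]
    ring
  rw [hasFDerivAt_pi']
  intro i
  fin_cases i
  · exact c0
  · exact c1

/-- On the triangle: `z₀ < ρ z₁` and `z₁ < ρ z₀`. [folklore] -/
theorem lt_rho_of_mem_tri2 {z : Fin 2 → ℝ} (hz : z ∈ tri2) : z 0 < rho (z 1) ∧ z 1 < rho (z 0) := by
  obtain ⟨⟨⟨a0, a1⟩, ⟨b0, b1⟩⟩, h⟩ := mem_tri2.mp hz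
  constructor
  · rw [rho, lt_div_iff₀ (by linarith)]; nlinarith
  · rw [rho, lt_div_iff₀ (by linarith)]; nlinarith

/-- On the triangle, `sin u₀ < cos u₁` and `sin u₁ < cos u₀`. [folklore] -/
theorem Sn_lt_Cs_of_mem_tri2 {z : Fin 2 → ℝ} (hz : z ∈ tri2) : Sn (z 0) < Cs (z 1) ∧ Sn (z 1) < Cs (z 0) := by
  obtain ⟨⟨⟨a0, a1⟩, ⟨b0, b1⟩⟩, -⟩ := mem_tri2.mp hz
  obtain ⟨h0, h1⟩ := lt_rho_of_mem_tri2 hz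
  constructor
  · rw [← Sn_rho (show z 1 ≠ -1 by linarith)]
    exact (Sn_lt_Sn_iff ⟨a0, a1⟩ (rho_mem_Ioo ⟨b0, b1⟩)).mpr h0
  · rw [← Sn_rho (show z 0 ≠ -1 by linarith)]
    exact (Sn_lt_Sn_iff ⟨b0, b1⟩ (rho_mem_Ioo ⟨a0, a1⟩)).mpr h1

/-- Auxiliary lemma `cal2_mem_cube2` (see the module docstring). [folklore] -/
theorem cal2_mem_cube2 {z : Fin 2 → ℝ} (hz : z ∈ tri2) : cal2 z ∈ cube2 := by
  obtain ⟨⟨⟨a0, a1⟩, ⟨b0, b1⟩⟩, -⟩ := mem_tri2.mp hz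
  obtain ⟨h0, h1⟩ := Sn_lt_Cs_of_mem_tri2 hz
  have s0 := Sn_pos ⟨a0, a1⟩; have s1 := Sn_pos ⟨b0, b1⟩
  have c0 := Cs_pos ⟨a0, a1⟩; have c1 := Cs_pos ⟨b0, b1⟩
  rw [mem_cube2]
  simp only [cal2_zero, cal2_one]
  refine ⟨⟨by positivity, ?_⟩, ⟨by positivity, ?_⟩⟩
  · rw [← div_eq_mul_inv, div_lt_one c1]; exact h0
  · rw [← div_eq_mul_inv, div_lt_one c0]; exact h1

/-- The key algebraic identity behind injectivity: `sin² u₀` is a rational function of `(x, y)`. [folklore] -/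
theorem Sn_sq_eq_of_cal2 {z : Fin 2 → ℝ} (hz : z ∈ tri2) :
    Sn (z 0) ^ 2 * (1 - (cal2 z 0) ^ 2 * (cal2 z 1) ^ 2) = (cal2 z 0) ^ 2 * (1 - (cal2 z 1) ^ 2) := by
  obtain ⟨⟨⟨a0, a1⟩, ⟨b0, b1⟩⟩, -⟩ := mem_tri2.mp hz
  have c0 := (Cs_pos ⟨a0, a1⟩).ne'; have c1 := (Cs_pos ⟨b0, b1⟩).ne'
  have e0 := Sn_sq_add_Cs_sq (z 0); have e1 := Sn_sq_add_Cs_sq (z 1)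
  simp only [cal2_zero, cal2_one]
  field_simp
  linear_combination (Sn (z 0)) ^ 2 * (Cs (z 0)) ^ 2 * e1 - (Sn (z 0)) ^ 2 * (Sn (z 1)) ^ 2 * e0

/-- Positivity: `one_sub_prod_sq_pos`. [folklore] -/
theorem one_sub_prod_sq_pos {z : Fin 2 → ℝ} (hz : z ∈ tri2) : 0 < 1 - (cal2 z 0) ^ 2 * (cal2 z 1) ^ 2 := by
  obtain ⟨⟨x0, x1⟩, ⟨y0, y1⟩⟩ := mem_cube2.mp (cal2_mem_cube2 hz)
  nlinarith [mul_pos x0 y0, mul_lt_one_of_nonneg_of_lt_one_left x0.le x1 y1.le]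

/-- `cal2` is injective on its domain. [folklore] -/
theorem injOn_cal2 : InjOn cal2 tri2 := by
  intro z hz z' hz' h
  obtain ⟨⟨⟨a0, a1⟩, ⟨b0, b1⟩⟩, -⟩ := mem_tri2.mp hz
  obtain ⟨⟨⟨a0', a1'⟩, ⟨b0', b1'⟩⟩, -⟩ := mem_tri2.mp hz'
  have hx : cal2 z 0 = cal2 z' 0 := congrFun h 0
  have hy : cal2 z 1 = cal2 z' 1 := congrFun h 1
  have k := Sn_sq_eq_of_cal2 hz
  have k' := Sn_sq_eq_of_cal2 hz'
  rw [hx, hy] at k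
  have hpos := one_sub_prod_sq_pos hz'
  have hsq : Sn (z 0) ^ 2 = Sn (z' 0) ^ 2 := by
    have := k.trans k'.symm
    exact mul_right_cancel₀ hpos.ne' this
  have h0 : Sn (z 0) = Sn (z' 0) := by
    have := Sn_pos ⟨a0, a1⟩; have := Sn_pos ⟨a0', a1'⟩
    nlinarith [hsq]
  have e0 : z 0 = z' 0 := Sn_inj ⟨a0, a1⟩ ⟨a0', a1'⟩ h0
  -- second coordinate: `y = Sn z1 / Cs z0` with equal `z0`
  have h1 : Sn (z 1) = Sn (z' 1) := by
    have c0 := (Cs_pos ⟨a0, a1⟩).ne'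
    simp only [cal2_one, e0] at hy
    exact mul_right_cancel₀ (inv_ne_zero ((Cs_pos ⟨a0', a1'⟩).ne')) hy
  have e1 : z 1 = z' 1 := Sn_inj ⟨b0, b1⟩ ⟨b0', b1'⟩ h1
  funext i; fin_cases i
  · exact e0
  · exact e1

/-! ### Surjectivity onto the square: the half-angle of an arcsine -/

/-- `T(s) = tan(arcsin(√s)/2) = √s/(1 + √(1−s))`. [folklore] -/
def Tg (s : ℝ) : ℝ := Real.sqrt s / (1 + Real.sqrt (1 - s))

/-- `T(s) ∈ (0,1)`, `sin(T s) = √s`, `cos(T s) = √(1−s)` in half-angle terms (the half-angle of an arcsine, algebraically). [folklore] -/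
theorem Tg_facts {s : ℝ} (hs : s ∈ Ioo (0 : ℝ) 1) :
    Tg s ∈ Ioo (0 : ℝ) 1 ∧ Sn (Tg s) = Real.sqrt s ∧ Cs (Tg s) = Real.sqrt (1 - s) := by
  obtain ⟨h0, h1⟩ := hs
  set q := Real.sqrt s with hq
  set r := Real.sqrt (1 - s) with hr
  have q0 : 0 < q := Real.sqrt_pos.mpr h0
  have r0 : 0 < r := Real.sqrt_pos.mpr (by linarith)
  have qq : q ^ 2 = s := Real.sq_sqrt h0.le
  have rr : r ^ 2 = 1 - s := Real.sq_sqrt (by linarith)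
  have key : q ^ 2 + r ^ 2 = 1 := by rw [qq, rr]; ring
  have q1 : q < 1 := by nlinarith
  have hT : Tg s = q / (1 + r) := rfl
  have d0 : (0 : ℝ) < 1 + r := by linarith
  refine ⟨⟨by rw [hT]; positivity, ?_⟩, ?_, ?_⟩
  · rw [hT, div_lt_one d0]; linarith
  · rw [hT, Sn]
    field_simp
    nlinarith [key]
  · rw [hT, Cs]
    field_simp
    nlinarith [key]

/-- The image of the domain under `cal2`. [folklore] -/
theorem image_cal2 : cal2 '' tri2 = cube2 := by
  apply Subset.antisymm
  · rintro _ ⟨z, hz, rfl⟩; exact cal2_mem_cube2 hz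
  · intro w hw
    obtain ⟨⟨x0, x1⟩, ⟨y0, y1⟩⟩ := mem_cube2.mp hw
    have hxy : w 0 ^ 2 * w 1 ^ 2 < 1 := by
      have := mul_lt_one_of_nonneg_of_lt_one_left x0.le x1 y1.le
      nlinarith [mul_pos x0 y0]
    have hD : 0 < 1 - w 0 ^ 2 * w 1 ^ 2 := by linarith
    have hD' : 1 - w 0 ^ 2 * w 1 ^ 2 ≠ 0 := hD.ne'
    have hD'' : 1 - w 1 ^ 2 * w 0 ^ 2 ≠ 0 := by rw [mul_comm]; exact hD'
    have hx2 : w 0 ^ 2 < 1 := by nlinarith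
    have hy2 : w 1 ^ 2 < 1 := by nlinarith
    have hx2' : 1 - w 0 ^ 2 ≠ 0 := by linarith
    have hy2' : 1 - w 1 ^ 2 ≠ 0 := by linarith
    -- `a = sin² u₀`, `b = sin² u₁`
    obtain ⟨a, ha⟩ : ∃ a : ℝ, a = w 0 ^ 2 * (1 - w 1 ^ 2) / (1 - w 0 ^ 2 * w 1 ^ 2) := ⟨_, rfl⟩
    obtain ⟨b, hb⟩ : ∃ b : ℝ, b = w 1 ^ 2 * (1 - w 0 ^ 2) / (1 - w 0 ^ 2 * w 1 ^ 2) := ⟨_, rfl⟩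
    have a_mem : a ∈ Ioo (0 : ℝ) 1 := by
      rw [ha]
      exact ⟨div_pos (mul_pos (pow_pos x0 2) (by linarith)) hD, (div_lt_one hD).mpr (by nlinarith)⟩
    have b_mem : b ∈ Ioo (0 : ℝ) 1 := by
      rw [hb]
      exact ⟨div_pos (mul_pos (pow_pos y0 2) (by linarith)) hD, (div_lt_one hD).mpr (by nlinarith)⟩
    obtain ⟨ta, sa, ca⟩ := Tg_facts a_mem
    obtain ⟨tb, sb, cb⟩ := Tg_facts b_mem
    have one_sub_b : 1 - b = (1 - w 1 ^ 2) / (1 - w 0 ^ 2 * w 1 ^ 2) := by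
      rw [hb]; field_simp; ring
    have one_sub_a : 1 - a = (1 - w 0 ^ 2) / (1 - w 0 ^ 2 * w 1 ^ 2) := by
      rw [ha]; field_simp; ring
    have hab : a / (1 - b) = w 0 ^ 2 := by
      rw [one_sub_b, ha]; field_simp
    have hba : b / (1 - a) = w 1 ^ 2 := by
      rw [one_sub_a, hb]; field_simp
    have hxa : Real.sqrt a * (Real.sqrt (1 - b))⁻¹ = w 0 := by
      rw [← div_eq_mul_inv, ← Real.sqrt_div a_mem.1.le, hab, Real.sqrt_sq x0.le]
    have hyb : Real.sqrt b * (Real.sqrt (1 - a))⁻¹ = w 1 := by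
      rw [← div_eq_mul_inv, ← Real.sqrt_div b_mem.1.le, hba, Real.sqrt_sq y0.le]
    have a_lt : a < 1 - b := by
      rw [one_sub_b, ha, div_lt_div_iff_of_pos_right hD]; nlinarith
    refine ⟨![Tg a, Tg b], ?_, ?_⟩
    · rw [mem_tri2]
      simp only [Matrix.cons_val_zero, Matrix.cons_val_one]
      refine ⟨⟨ta, tb⟩, ?_⟩
      have hρ : Tg a < rho (Tg b) := by
        rw [← Sn_lt_Sn_iff ta (rho_mem_Ioo tb), Sn_rho (show Tg b ≠ -1 by linarith [tb.1]), sa, cb]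
        exact (Real.sqrt_lt_sqrt_iff a_mem.1.le).mpr a_lt
      rw [rho, lt_div_iff₀ (by linarith [tb.1])] at hρ
      nlinarith
    · funext i; fin_cases i
      · simp only [cal2]; simp [sa, cb, hxa]
      · simp only [cal2]; simp [sb, ca, hyb]

/-- `cal2` is a `ℚ`-semialgebraic map on its domain (rational or polynomial components). [folklore] -/
theorem isSemialgebraicMapOn_cal2 : IsSemialgebraicMapOn ℚ tri2 cal2 := by
  refine IsSemialgebraicMapOn.of_forall sa_tri2 fun j => ?_
  have den : ∀ z ∈ tri2, ∀ i : Fin 2, (aeval z) ((1 + X i ^ 2) * (1 - X (1 - i) ^ 2) : MvPolynomial (Fin 2) ℚ) ≠ 0 := by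
    intro z hz i
    obtain ⟨⟨⟨a0, a1⟩, ⟨b0, b1⟩⟩, -⟩ := mem_tri2.mp hz
    simp only [map_mul, map_add, map_one, map_pow, map_sub, aeval_X]
    refine mul_ne_zero (one_add_sq_ne _) ?_
    fin_cases i <;> simp <;> nlinarith
  fin_cases j
  · refine (isSemialgebraicFunOn_aeval_div_aeval sa_tri2 (2 * X 0 * (1 + X 1 ^ 2) : MvPolynomial (Fin 2) ℚ)
      ((1 + X 0 ^ 2) * (1 - X 1 ^ 2)) (fun z hz => den z hz 0)).congr fun z hz => ?_
    obtain ⟨⟨⟨a0, a1⟩, ⟨b0, b1⟩⟩, -⟩ := mem_tri2.mp hz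
    have : (1 : ℝ) - z 1 ^ 2 ≠ 0 := by nlinarith
    have := one_add_sq_ne (z 0); have := one_add_sq_ne (z 1)
    simp [cal2, Sn, Cs]
    field_simp
  · refine (isSemialgebraicFunOn_aeval_div_aeval sa_tri2 (2 * X 1 * (1 + X 0 ^ 2) : MvPolynomial (Fin 2) ℚ)
      ((1 + X 1 ^ 2) * (1 - X 0 ^ 2)) (fun z hz => by simpa using den z hz 1)).congr fun z hz => ?_
    obtain ⟨⟨⟨a0, a1⟩, ⟨b0, b1⟩⟩, -⟩ := mem_tri2.mp hz
    have : (1 : ℝ) - z 0 ^ 2 ≠ 0 := by nlinarith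
    have := one_add_sq_ne (z 0); have := one_add_sq_ne (z 1)
    simp [cal2, Sn, Cs]
    field_simp

/-- `[□², 1/(1−x²y²)]` (value `Σ_{odd} n⁻² = ¾ζ(2)`), integrability transported from the triangle. [folklore] -/
def T2rep : KZ.IntegralRep 2 where
  domain := cube2
  integrand w := 1 / (1 - w 0 ^ 2 * w 1 ^ 2)
  isSemialgebraic_domain := isSemialgebraic_openUnitCube
  isSemialgebraicFunOn_integrand := by
    refine (isSemialgebraicFunOn_aeval_div_aeval (isSemialgebraic_openUnitCube (d := 2))
      (1 : MvPolynomial (Fin 2) ℚ) (1 - X 0 ^ 2 * X 1 ^ 2) fun w hw => ?_).congr fun w hw => ?_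
    · obtain ⟨⟨x0, x1⟩, ⟨y0, y1⟩⟩ := mem_cube2.mp hw
      simp only [map_sub, map_one, map_mul, map_pow, aeval_X]
      have := mul_lt_one_of_nonneg_of_lt_one_left x0.le x1 y1.le
      nlinarith [mul_pos x0 y0]
    · simp
  integrableOn := by
    have key : ∀ z ∈ tri2, |(cal2Deriv z).det| • (fun w : Fin 2 → ℝ => 1 / (1 - w 0 ^ 2 * w 1 ^ 2)) (cal2 z) =
        Trirep.integrand z := by
      intro z hz
      obtain ⟨⟨⟨a0, a1⟩, ⟨b0, b1⟩⟩, -⟩ := mem_tri2.mp hz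
      have hp := one_sub_prod_sq_pos hz
      rw [det_cal2Deriv (Cs_pos ⟨a0, a1⟩).ne' (Cs_pos ⟨b0, b1⟩).ne',
        abs_of_pos (mul_pos (mul_pos (gq_pos _) (gq_pos _)) hp), smul_eq_mul]
      change _ = G2.integrand z
      rw [G2_integrand_apply]
      field_simp
    have hf' : ∀ z ∈ tri2, HasFDerivWithinAt cal2 (cal2Deriv z) tri2 z := fun z hz => by
      obtain ⟨⟨⟨a0, a1⟩, ⟨b0, b1⟩⟩, -⟩ := mem_tri2.mp hz
      exact (hasFDerivAt_cal2 (Cs_pos ⟨a0, a1⟩).ne' (Cs_pos ⟨b0, b1⟩).ne').hasFDerivWithinAt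
    have h := (integrableOn_image_iff_integrableOn_abs_det_fderiv_smul volume
      (sa_tri2.measurableSet_holds) hf' injOn_cal2 (fun w : Fin 2 → ℝ => 1 / (1 - w 0 ^ 2 * w 1 ^ 2))).mpr
      (Trirep.integrableOn.congr_fun (fun z hz => (key z hz).symm) sa_tri2.measurableSet_holds)
    rwa [image_cal2] at h

/-- **The Calabi change of variables is ONE move**: `[P₂, g⊗g] − [□², 1/(1−x²y²)] ∈ rule (2)`. [folklore] -/
theorem Trirep_sub_T2rep_mem_cov : KZ.of Trirep - KZ.of T2rep ∈ KZ.changeOfVariablesRel := by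
  refine ⟨2, Trirep, T2rep, cal2, fun z => cal2Deriv z, isSemialgebraicMapOn_cal2, fun z hz => ?_, injOn_cal2,
    image_cal2.symm, fun z hz => ?_, rfl⟩
  · obtain ⟨⟨⟨a0, a1⟩, ⟨b0, b1⟩⟩, -⟩ := mem_tri2.mp hz
    exact (hasFDerivAt_cal2 (Cs_pos ⟨a0, a1⟩).ne' (Cs_pos ⟨b0, b1⟩).ne').hasFDerivWithinAt
  · obtain ⟨⟨⟨a0, a1⟩, ⟨b0, b1⟩⟩, -⟩ := mem_tri2.mp hz
    have hp := one_sub_prod_sq_pos hz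
    change G2.integrand z = (1 / (1 - (cal2 z 0) ^ 2 * (cal2 z 1) ^ 2)) * |(cal2Deriv z).det|
    rw [det_cal2Deriv (Cs_pos ⟨a0, a1⟩).ne' (Cs_pos ⟨b0, b1⟩).ne',
      abs_of_pos (mul_pos (mul_pos (gq_pos _) (gq_pos _)) hp), G2_integrand_apply]
    field_simp

/-- **`Q² ≡ 2·[□², 1/(1−x²y²)]`** (`(π/2)² = 2 · Σ_{odd} n⁻²`). [folklore] -/
theorem of_G2_sub_two_T2rep_mem : KZ.of G2 - 2 • KZ.of T2rep ∈ KZ.relations := by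
  have h1 := of_G2_sub_two_Trirep_mem
  have h2 := KZ.changeOfVariablesRel_subset_relations Trirep_sub_T2rep_mem_cov
  have : KZ.of G2 - 2 • KZ.of T2rep = (KZ.of G2 - 2 • KZ.of Trirep) + 2 • (KZ.of Trirep - KZ.of T2rep) := by
    rw [two_nsmul, two_nsmul]; abel
  rw [this]
  exact add_mem h1 (KZ.relations.nsmul_mem h2 2)

end Summit.KontsevichZagierPeriods.MzvKernelInKZ.Negative
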